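import Literature.Analysis.FluidPDE.LocalTypeI
import HarnessLib

/-!
# Two measure-theoretic tools for the enabler `tangentFlowTransfer_finiteAB`
# (route `AdaptedFrequency`; sub-goals W3a, W3b for the crux `FrequencyRigidity`,
# stmt-NavierStokesRegularity-2955, line `scaled-energy-split`)

The assembly of `tangentFlowTransfer_finiteAB` identifies two limits of one sequence of zoomed
velocity fields on each parabolic ball `Q(0, a) = (-a², 0) × B_a(0)`: the Albritton–Barker
`L³`-limit `g` and the route's pointwise (`C²_loc`) limit `h`.

* `finiteAB_ae_eq_of_tendsto_eLpNorm_of_tendsto_ae`: an `Lᵖ`-limit (`p ≠ 0`) and an a.e.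
  pointwise limit of the same sequence agree a.e. (convergence in measure, a.e. convergent
  subsequence, uniqueness of limits).
* `finiteAB_ae_lowerHalf_of_forall_parabolicCylinder`: a property holding a.e. on every
  parabolic ball `Q(0, n + 1)`, `n : ℕ`, holds a.e. on the lower half space `(-∞, 0) × ℝ³`
  (the balls exhaust it; a.e. on a countable union).
-/

noncomputable section

set_option linter.dupNamespace false

namespace Summit.NavierStokesRegularity.NavierStokesRegularity.Theorems

open scoped Topology
open Literature.Analysis Literature.Analysis.FluidPDE Set Filter MeasureTheory

/-- **An `Lᵖ`-limit and an a.e. pointwise limit of one sequence agree a.e.** If `f n → g` in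
`eLpNorm · p μ` (`p ≠ 0`, all `f n` and `g` a.e. strongly measurable) and `f n x → h x` for
`μ`-a.e. `x`, then `g = h` `μ`-a.e.: `Lᵖ`-convergence gives convergence in measure, hence an
a.e. convergent subsequence with limit `g`; along it the pointwise limit is still `h`; limits in
the Hausdorff space `ℝ³` are unique. [folklore] -/
theorem finiteAB_ae_eq_of_tendsto_eLpNorm_of_tendsto_ae : ∀ (μ : MeasureTheory.Measure (ℝ × EuclideanSpace ℝ (Fin 3))) (p : ENNReal), p ≠ 0 → ∀ (f : ℕ → ℝ × EuclideanSpace ℝ (Fin 3) → EuclideanSpace ℝ (Fin 3)) (g h : ℝ × EuclideanSpace ℝ (Fin 3) → EuclideanSpace ℝ (Fin 3)), (∀ n, MeasureTheory.AEStronglyMeasurable (f n) μ) → MeasureTheory.AEStronglyMeasurable g μ → Filter.Tendsto (fun n => MeasureTheory.eLpNorm (f n - g) p μ) Filter.atTop (nhds 0) → (∀ᵐ x ∂μ, Filter.Tendsto (fun n => f n x) Filter.atTop (nhds (h x))) → g =ᵐ[μ] h := by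
  intro μ p hp f g h hf hg hL hpt
  -- convergence in measure and an a.e. convergent subsequence with limit `g`
  obtain ⟨ns, hns, hae⟩ := (tendstoInMeasure_of_tendsto_eLpNorm hp hf hg hL).exists_seq_tendsto_ae
  filter_upwards [hae, hpt] with x hxg hxh
  -- along the subsequence the pointwise limit is still `h x`; limits are unique
  exact tendsto_nhds_unique hxg (hxh.comp hns.tendsto_atTop)

/-- **A.e. on every parabolic ball `Q(0, n + 1)` implies a.e. on the lower half space.** The
parabolic balls `Q(0, n + 1) = (-(n + 1)², 0) × B_{n+1}(0)`, `n : ℕ`, cover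
`(-∞, 0) × ℝ³` (for `t < 0` take `n = ⌈max √(-t) ‖x‖⌉₊`), so a property holding
`volume`-a.e. on each of them holds `volume`-a.e. on their (countable) union and hence on the
lower half space. [folklore] -/
theorem finiteAB_ae_lowerHalf_of_forall_parabolicCylinder : ∀ (P : ℝ × EuclideanSpace ℝ (Fin 3) → Prop), (∀ n : ℕ, ∀ᵐ z ∂(MeasureTheory.Measure.restrict MeasureTheory.volume (Literature.Analysis.FluidPDE.parabolicCylinder ((n:ℝ) + 1) (0 : ℝ × EuclideanSpace ℝ (Fin 3)))), P z) → ∀ᵐ z ∂(MeasureTheory.Measure.restrict MeasureTheory.volume (Set.Iio (0:ℝ) ×ˢ (Set.univ : Set (EuclideanSpace ℝ (Fin 3))))), P z := by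
  intro P hP
  -- the parabolic balls `Q(0, n + 1)` exhaust the lower half space
  have hcov : Set.Iio (0:ℝ) ×ˢ (Set.univ : Set (EuclideanSpace ℝ (Fin 3))) ⊆
      ⋃ n : ℕ, parabolicCylinder ((n:ℝ) + 1) (0 : ℝ × EuclideanSpace ℝ (Fin 3)) := by
    rintro ⟨t, x⟩ ⟨ht, -⟩
    rw [Set.mem_Iio] at ht
    set n : ℕ := ⌈max (Real.sqrt (-t)) ‖x‖⌉₊ with hn
    have hle : max (Real.sqrt (-t)) ‖x‖ ≤ (n : ℝ) := Nat.le_ceil _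
    have hlt : max (Real.sqrt (-t)) ‖x‖ < (n : ℝ) + 1 := lt_of_le_of_lt hle (lt_add_one _)
    have hsq : Real.sqrt (-t) < (n : ℝ) + 1 := lt_of_le_of_lt (le_max_left _ _) hlt
    have hnx : ‖x‖ < (n : ℝ) + 1 := lt_of_le_of_lt (le_max_right _ _) hlt
    have hn1 : (0 : ℝ) < (n : ℝ) + 1 := by positivity
    have ht' : -t < ((n : ℝ) + 1) ^ 2 := (Real.sqrt_lt' hn1).1 hsq
    refine Set.mem_iUnion.2 ⟨n, ?_⟩
    rw [mem_parabolicCylinder]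
    refine ⟨⟨?_, ?_⟩, ?_⟩
    · simp only [Prod.fst_zero, zero_sub]
      linarith
    · simpa using ht
    · simpa [dist_zero_right] using hnx
  -- a.e. on each piece of a countable union ⇒ a.e. on the union ⇒ a.e. on the subset
  exact ae_restrict_of_ae_restrict_of_subset hcov ((ae_restrict_iUnion_iff _ _).2 hP)

end Summit.NavierStokesRegularity.NavierStokesRegularity.Theorems
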